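import Summits.NavierStokesRegularity.NavierStokesRegularity.Theses.RellichScar

/-!
# Route RellichScar — the assembly item (pure logic)

`Assembly` (item stmt-NavierStokesRegularity-11724) records, with all hypotheses inlined verbatim,
the implication chain

  NoApexTypeIProfile → ApexLocalisation → TypeIBlowupProfile → NoTypeII → ClayFromNoBlowup
    → NavierStokesRegularity.

The proof is the `X`-branch of the route's deciding theorem `closes`: apply `ClayFromNoBlowup`;
a classical Leray–Hopf solution from a rapidly decaying datum with no smooth extension past `T`
is maximal (`IsMaximalSmoothSolution := ⟨classical, ¬ extension⟩`); `NoTypeII` gives the Type-I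
rate; `TypeIBlowupProfile` a rate-Type-I profile singular at the origin; `ApexLocalisation` an
apex profile singular at the origin; and `NoApexTypeIProfile` says no such profile is singular
there — contradiction.
-/

-- the summit and its single sub-problem share the name (CONVENTIONS §1), as in every Theorems file
set_option linter.dupNamespace false

namespace Summit.NavierStokesRegularity.NavierStokesRegularity.Theorems

/-- The assembly item of route RellichScar (stmt-NavierStokesRegularity-11724): the chain
`NoApexTypeIProfile → ApexLocalisation → TypeIBlowupProfile → NoTypeII → ClayFromNoBlowup →
NavierStokesRegularity`, hypotheses inlined verbatim. Pure logic (modus ponens plus maximality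
rendered as the anonymous pair ⟨classical on `Ico 0 T`, no smooth extension past `T`⟩). -/
theorem rellichScar_assembly_proof :
    Summit.NavierStokesRegularity.NavierStokesRegularity.Theses.RellichScar.Assembly := by
  unfold Summit.NavierStokesRegularity.NavierStokesRegularity.Theses.RellichScar.Assembly
  intro hX hLoc hP hII hClay
  apply hClay
  intro ν T hν hT u p hcl hLH hdec
  by_contra hext
  -- a classical Leray–Hopf solution with no smooth extension past `T` is maximal;
  -- `NoTypeII` gives the Type-I rate
  have hI : Literature.Analysis.FluidPDE.IsTypeIBlowup u T := hII ν T hν hT u p ⟨hcl, hext⟩ hLH hdec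
  -- Type-I-rate blow-up ⇒ a local-energy profile with the Type-I rate, singular at the origin
  obtain ⟨w, q, H, C, hsw, hgr, hIb, hdecay, hsing⟩ := hP ν T hν hT u p ⟨hcl, hext⟩ hLH hdec hI
  -- localisation ⇒ a profile with the space–time Type-I bound at the apex, singular at the origin
  obtain ⟨C', v, q', H', hsw', hgr', hIb', hdec', hsing'⟩ :=
    hLoc C ⟨w, q, H, hsw, hgr, hIb, hdecay, hsing⟩
  -- `X`: no apex Type-I profile is singular at the origin
  exact hX v q' H' C' hsw' hgr' hIb' hdec' hsing'

end Summit.NavierStokesRegularity.NavierStokesRegularity.Theorems
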